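import Literature.IUT.LogVolume.TensorPacketContentBounds
import Literature.IUT.LogVolume.LogVolumeEstimatesFirst
import Literature.IUT.LogVolume.TensorPacketSlotUnion
import HarnessLib

/-!
# The VOLUME-FORM window for the hull of an (Ind2)-orbit: the hull defect of `log_p(R_I^×)` and the
# first inequality of [IUTchIV] Prop. 1.4 (iii) (Dupuy–Hilado §4.9–4.12; [IUTchIV] Prop. 1.2, 1.4)

Sequel (abc-iut cell, prover seat abc-iut-w5-d082, item XXVIIc of `HOME/skel/FORK-REAL-MODEL.md` §4) to
abc-iut-w5-d180's `TensorPacketOrbitVolume` / `TensorPacketContentBounds`: there, for a bounded region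
`M ⊄ {0}` of the packet `V = ⊗_{ℚ_p} k_i` with content `m` w.r.t. `Λ := log_p(R_I^×)`,

  `log μ̄(hull(⋃_{γ ∈ Ind2} γ·M)) = −m·log p + H`,  `H := log μ̄(hull(Λ))`  (exact),

and `m` was bracketed through the [IUTchIV] Prop. 1.2 (i) sandwich `⊗α_i·R_I ⊆ Λ ⊆ ⊗h_i·(R_I)^∼`. HERE the
same `m` is bracketed by VOLUMES, which is sharper at the lower end and puts the upper end in the currency of
the FIRST displayed inequality of [IUTchIV] Prop. 1.4 (iii):

* `content_mul_log_le_of_smul_subset` (volume form of the content upper bound): if the bare region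
  `ι_i(g)·(R_I)^∼` lies in `p^m·Λ` then `m·log p ≤ −log‖g‖ + log μ̄(Λ)` (monotonicity of `log μ̄`,
  `log μ̄(ι_i(g)·(R_I)^∼) = log‖g‖`, `log μ̄(p^m·Λ) = −m·log p + log μ̄(Λ)`); since `log μ̄(Λ) ≤ b_I·log p`
  (`packetLogμ_logPacket_le_bSum`, from `Λ ⊆ ⊗h·(R_I)^∼`) this implies the sandwich bound
  `m·log p ≤ b_I·log p − log‖g‖` of `TensorPacketContentBounds.content_le_of_iota_mem` on such regions;
* `packetLogμ_logPacket_le_packetHull`, `packetLogμ_packetHull_logPacket_le_bSum`: `log μ̄(Λ) ≤ H ≤ b_I·log p`,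
  so the HULL DEFECT `δ_Λ := H − log μ̄(Λ)` of the log-shell lattice is `≥ 0` (and the sandwich lower end
  `log‖g‖ − b_I·log p + H` never exceeds the trivial `log‖g‖`);
* `packetLogμ_packetHull_orbit_ge_defect`: **`log‖g‖ + δ_Λ ≤ log μ̄(hull(⋃_γ γ·M))`** for bounded
  `M ⊇ ι_i(g)·(R_I)^∼` — the trivial bound improved by exactly the hull defect;
* `packetLogμ_zpow_smul_logPacket_le_first`: [IUTchIV] Prop. 1.4 (iii), FIRST inequality (abc-iut-S8/S7's
  `Prop14iii₁_holds`) read in the packet's `log μ̄`: `log μ̄(p^{⌊λ−d_I−a_I⌋}·Λ) ≤ {−λ + d_I + 1 + 4|I*|/p}·log p`;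
* `packetLogμ_packetHull_orbit_le_first`: hence, for bounded `M ⊄ {0}` inside `⋃_i ι_i(g_i)·(R_I)^∼`
  (`ord(g_i) = λ_i`, `λ_min` the least), **`log μ̄(hull(⋃_γ γ·M)) ≤ δ_Λ + {−λ_min + d_I + 1 + 4|I*|/p}·log p`**;
* `packetLogμ_packetHull_orbit_window`: both together — the orbit-hull volume sits in a window of width
  `{λ − λ_min + d_I + 1 + 4|I*|/p}·log p` above `log‖g‖ + δ_Λ`, with NO `a_I`, `b_I` (wildness enters only
  through `4|I*|/p`), located at the one packet invariant `δ_Λ`.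

[cite: Mochizuki2012, IUTchIV Prop. 1.2 (i)(ii) p. 10, Prop. 1.4 (iii) p. 13] [cite: DupuyHilado2025, §4.9, §4.12]
HONEST SCOPE: summand level; (Ind2)/the hull are the tree's typings of disputed-corpus constructions
[claim: Mochizuki2012, status: disputed]; nothing here takes a side on [IUTchIII] Cor. 3.12; `δ_Λ` is left as a
term (it vanishes iff `hull(Λ)` and `Λ` have the same volume, e.g. when `Λ` is an `(R_I)^∼`-module).
PROOF-ONLY file: no definitions, no named `Prop` facts.
-/

noncomputable section

open Set Module
open scoped Pointwise TensorProduct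

namespace Literature.IUT.LogVolume

variable (p : ℕ) [Fact p.Prime]
variable {I : Type} [Fintype I] [DecidableEq I] [Nonempty I]
variable (k : I → Type) [∀ i, NontriviallyNormedField (k i)] [∀ i, NormedAlgebra ℚ_[p] (k i)]
  [∀ i, IsUltrametricDist (k i)] [∀ i, ProperSpace (k i)]

/-! ## Scalar multiples of the log-shell lattice -/

/-- `p^m·log_p(R_I^×)` is admissible. [cite: DupuyHilado2025, §4 (intro)] -/
theorem packetAdm_zpow_smul_logPacket (m : ℤ) :
    PacketAdm p k (((p : ℚ_[p]) ^ m) • (logPacket p k : Set (PacketAlgebra p k))) :=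
  packetAdm_const_smul p k (zpow_ne_zero m (Nat.cast_ne_zero.mpr (Fact.out : p.Prime).ne_zero))
    (packetAdm_logPacket p k)

/-- **`log μ̄(p^m·log_p(R_I^×)) = −m·log p + log μ̄(log_p(R_I^×))`** ("Mochizuki normalised" scaling).
[cite: DupuyHilado2025, Rmk. 3.5.4] -/
theorem packetLogμ_zpow_smul_logPacket (m : ℤ) :
    packetLogμ p k (((p : ℚ_[p]) ^ m) • (logPacket p k : Set (PacketAlgebra p k))) =
      -(m * Real.log p) + packetLogμ p k (logPacket p k : Set (PacketAlgebra p k)) := by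
  rw [← ppow_smul_set_eq]
  exact packetLogμ_ppow_smul p k m (packetAdm_logPacket p k)

/-! ## The volume form of the content upper bound -/

/-- **Volume form of the content upper bound**: if the bare region `ι_i(g)·(R_I)^∼` (`g ≠ 0`) lies in
`p^m·log_p(R_I^×)`, then `m·log p ≤ −log‖g‖ + log μ̄(log_p(R_I^×))` — compare the volumes `log‖g‖` and
`−m·log p + log μ̄(log_p(R_I^×))` of the two admissible regions. [cite: DupuyHilado2025, §3.7, Rmk. 3.5.4] -/
theorem content_mul_log_le_of_smul_subset {i : I} {g : k i} (hg0 : g ≠ 0) {m : ℤ}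
    (h : iota p k i g • (normalizedPacket p k : Set (PacketAlgebra p k)) ⊆
      ((p : ℚ_[p]) ^ m) • (logPacket p k : Set (PacketAlgebra p k))) :
    (m : ℝ) * Real.log p ≤ -Real.log ‖g‖ + packetLogμ p k (logPacket p k : Set (PacketAlgebra p k)) := by
  have hmono := packetLogμ_mono p k
    (packetAdm_iota_smul p k i hg0 (packetAdm_normalizedPacket p k)) (packetAdm_zpow_smul_logPacket p k m) h
  rw [packetLogμ_iota_smul_normalizedPacket p k i hg0, packetLogμ_zpow_smul_logPacket] at hmono
  linarith

/-! ## `log μ̄(log_p(R_I^×)) ≤ log μ̄(hull(log_p(R_I^×))) ≤ b_I·log p` -/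

/-- `log μ̄(⊗h·(R_I)^∼) = b_I·log p` for a family `h` realising `p^{−b_I}` (`‖h_i‖ = p^{b_i}`; every factor of
`ψ(⊗h)` has norm `∏‖h_i‖ = p^{b_I}`). [cite: Mochizuki2012, IUTchIV Prop. 1.4 (iii) proof p. 14] -/
theorem packetLogμ_purePacket_smul_normalizedPacket_of_realizesNegB {h : Π i, k i}
    (hh : RealizesNegB p k h) :
    packetLogμ p k (purePacket p k h • (normalizedPacket p k : Set (PacketAlgebra p k))) =
      bSum p k * Real.log p := by
  have h0 := packetLogVolume_ppow_mul_purePacket_smul p k (DFac p k) (dEquiv p k) 0 h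
    (ne_zero_of_realizesNegB p k hh)
  have h1 : ppow p k 0 = 1 := by rw [ppow, zpow_zero, map_one]
  rw [h1, one_mul, Int.cast_zero, zero_mul, neg_zero, zero_add] at h0
  have hsum : ∑ i, Real.log ‖h i‖ = bSum p k * Real.log p := by
    rw [bSum, Finset.sum_mul]
    exact Finset.sum_congr rfl fun i _ => (RealizesNegB.log_norm p k hh i).2
  rw [← hsum]
  exact h0

omit [Fintype I] [DecidableEq I] [Nonempty I] in
/-- `log_p(R_I^×) ⊆ ⊗h·(R_I)^∼` for EVERY realisation `h` of `p^{−b_I}` ([IUTchIV] p. 11, fourth inclusion, and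
`R_I ⊆ (R_I)^∼`). [cite: Mochizuki2012, IUTchIV Prop. 1.2 (i) p. 10] -/
theorem logPacket_subset_purePacket_smul_normalizedPacket_of_realizesNegB {h : Π i, k i}
    (hh : RealizesNegB p k h) :
    (logPacket p k : Set (PacketAlgebra p k)) ⊆
      purePacket p k h • (normalizedPacket p k : Set (PacketAlgebra p k)) := fun w hw => by
  obtain ⟨y, hy, rfl⟩ := exists_mem_integerPacket_of_mem_logPacket p k hh hw
  exact ⟨y, integerPacket_le_normalizedPacket p k hy, rfl⟩

/-- **`log μ̄(log_p(R_I^×)) ≤ b_I·log p`** (from `log_p(R_I^×) ⊆ ⊗h·(R_I)^∼`). So the volume-form content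
bound implies the sandwich bound `m·log p ≤ b_I·log p − log‖g‖`. [cite: Mochizuki2012, IUTchIV Prop. 1.2 (i) p. 10] -/
theorem packetLogμ_logPacket_le_bSum :
    packetLogμ p k (logPacket p k : Set (PacketAlgebra p k)) ≤ bSum p k * Real.log p := by
  obtain ⟨h, hh⟩ := exists_realizesNegB p k
  have hmono := packetLogμ_mono p k (packetAdm_logPacket p k)
    (packetAdm_smul_normalizedPacket p k _
      (dEquiv_purePacket_ne_zero p k (ne_zero_of_realizesNegB p k hh)))
    (logPacket_subset_purePacket_smul_normalizedPacket_of_realizesNegB p k hh)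
  rwa [packetLogμ_purePacket_smul_normalizedPacket_of_realizesNegB p k hh] at hmono

/-- **`log μ̄(log_p(R_I^×)) ≤ log μ̄(hull(log_p(R_I^×)))`**: the hull defect `δ_Λ` is nonnegative.
[cite: DupuyHilado2025, §4.12] -/
theorem packetLogμ_logPacket_le_packetHull :
    packetLogμ p k (logPacket p k : Set (PacketAlgebra p k)) ≤
      packetLogμ p k (packetHull p k (logPacket p k : Set (PacketAlgebra p k))) :=
  packetLogμ_mono p k (packetAdm_logPacket p k) (packetAdm_packetHull_logPacket p k)
    (subset_packetHull p k _)

/-- **`log μ̄(hull(log_p(R_I^×))) ≤ b_I·log p`**: the hull lies in the hull-closed translate `⊗h·(R_I)^∼`.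
[cite: DupuyHilado2025, §4.12] [cite: Mochizuki2012, IUTchIV Prop. 1.2 (i) p. 10] -/
theorem packetLogμ_packetHull_logPacket_le_bSum :
    packetLogμ p k (packetHull p k (logPacket p k : Set (PacketAlgebra p k))) ≤ bSum p k * Real.log p := by
  obtain ⟨h, hh⟩ := exists_realizesNegB p k
  have hle := packetLogμ_packetHull_le_smul_normalizedPacket p k
    (dEquiv_purePacket_ne_zero p k (ne_zero_of_realizesNegB p k hh)) (packetAdm_logPacket p k)
    Set.Subset.rfl (logPacket_subset_purePacket_smul_normalizedPacket_of_realizesNegB p k hh)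
  rwa [packetLogμ_purePacket_smul_normalizedPacket_of_realizesNegB p k hh] at hle

/-- The hull defect is at most `b_I·log p − log μ̄(log_p(R_I^×))`. [cite: DupuyHilado2025, §4.12] -/
theorem packetLogμ_packetHull_logPacket_sub_le :
    packetLogμ p k (packetHull p k (logPacket p k : Set (PacketAlgebra p k))) -
        packetLogμ p k (logPacket p k : Set (PacketAlgebra p k)) ≤
      bSum p k * Real.log p - packetLogμ p k (logPacket p k : Set (PacketAlgebra p k)) := by
  linarith [packetLogμ_packetHull_logPacket_le_bSum p k]

/-! ## The lower end of the window: the trivial bound improved by the hull defect -/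

/-- **Lower end, volume form**: for a bounded region `M` containing the bare region `ι_i(g)·(R_I)^∼` (`g ≠ 0`),
`log‖g‖ + δ_Λ ≤ log μ̄(hull(⋃_{γ ∈ Ind2} γ·M))`, `δ_Λ = log μ̄(hull(log_p(R_I^×))) − log μ̄(log_p(R_I^×)) ≥ 0`.
[cite: DupuyHilado2025, §4.9, §4.12] -/
theorem packetLogμ_packetHull_orbit_ge_defect {M : Set (PacketAlgebra p k)} (hMb : IsPsiBounded p k M)
    {i : I} {g : k i} (hg0 : g ≠ 0)
    (hgM : iota p k i g • (normalizedPacket p k : Set (PacketAlgebra p k)) ⊆ M) :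
    Real.log ‖g‖ + (packetLogμ p k (packetHull p k (logPacket p k : Set (PacketAlgebra p k))) -
        packetLogμ p k (logPacket p k : Set (PacketAlgebra p k))) ≤
      packetLogμ p k (packetHull p k (⋃ γ : indTwo p k, γ • M)) := by
  have hM0 : ∃ x ∈ M, x ≠ 0 := by
    refine ⟨iota p k i g, hgM ⟨1, Subring.one_mem _, ?_⟩, (map_ne_zero (iota p k i)).mpr hg0⟩
    change iota p k i g * 1 = iota p k i g
    rw [mul_one]
  obtain ⟨m, hm, -, -, hvol⟩ := exists_packetLogμ_packetHull_orbit_eq p k hMb hM0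
  have hc := content_mul_log_le_of_smul_subset p k hg0 (hgM.trans hm)
  rw [hvol]
  linarith

/-- In particular `log‖g‖ ≤ log μ̄(hull(⋃_γ γ·M))` (the trivial lower end, as `δ_Λ ≥ 0`).
[cite: DupuyHilado2025, §4.12] -/
theorem packetLogμ_packetHull_orbit_ge_log_norm {M : Set (PacketAlgebra p k)} (hMb : IsPsiBounded p k M)
    {i : I} {g : k i} (hg0 : g ≠ 0)
    (hgM : iota p k i g • (normalizedPacket p k : Set (PacketAlgebra p k)) ⊆ M) :
    Real.log ‖g‖ ≤ packetLogμ p k (packetHull p k (⋃ γ : indTwo p k, γ • M)) := by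
  have h1 := packetLogμ_packetHull_orbit_ge_defect p k hMb hg0 hgM
  have h2 := packetLogμ_logPacket_le_packetHull p k
  linarith

/-! ## The upper end of the window: [IUTchIV] Prop. 1.4 (iii), first inequality -/

omit [Nonempty I] in
/-- **[IUTchIV] Prop. 1.4 (iii), first displayed inequality, in the packet's `log μ̄`**: for `|I| ≥ 2`, `I* ⊇` the
non-tame slots, `i† ∈ I`, `λ = m₀/e_{i†}`, `n = ⌊λ − d_I − a_I⌋`:
`log μ̄(p^n·log_p(R_I^×)) ≤ {−λ + d_I + 1 + 4|I*|/p}·log p` (abc-iut-S8's `Prop14iii₁_holds` along the chosen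
decomposition `ψ`). [cite: Mochizuki2012, IUTchIV Prop. 1.4 (iii) p. 13] -/
theorem packetLogμ_zpow_smul_logPacket_le_first (hI : 2 ≤ Fintype.card I) (Istar : Finset I)
    (htame : ∀ i, i ∉ Istar → absRamificationIdx p (k i) ≤ p - 2) (i : I) (m₀ : ℤ) :
    packetLogμ p k (((p : ℚ_[p]) ^ ⌊(m₀ : ℝ) / absRamificationIdx p (k i) - dSum p k - aSum p k⌋) •
        (logPacket p k : Set (PacketAlgebra p k))) ≤
      (-((m₀ : ℝ) / absRamificationIdx p (k i)) + dSum p k + 1 + 4 * (Istar.card : ℝ) / p) * Real.log p := by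
  have h := Prop14iii₁_holds p k (DFac p k) (dEquiv p k) hI Istar htame i m₀
  rw [ppow_smul_set_eq] at h
  exact h

omit [Nonempty I] in
/-- The same with the content term isolated: `−n·log p + log μ̄(log_p(R_I^×)) ≤ {−λ + d_I + 1 + 4|I*|/p}·log p`.
[cite: Mochizuki2012, IUTchIV Prop. 1.4 (iii) p. 13] -/
theorem neg_floor_mul_log_add_packetLogμ_logPacket_le (hI : 2 ≤ Fintype.card I) (Istar : Finset I)
    (htame : ∀ i, i ∉ Istar → absRamificationIdx p (k i) ≤ p - 2) (i : I) (m₀ : ℤ) :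
    -(⌊(m₀ : ℝ) / absRamificationIdx p (k i) - dSum p k - aSum p k⌋ * Real.log p) +
        packetLogμ p k (logPacket p k : Set (PacketAlgebra p k)) ≤
      (-((m₀ : ℝ) / absRamificationIdx p (k i)) + dSum p k + 1 + 4 * (Istar.card : ℝ) / p) * Real.log p := by
  haveI : Nonempty I := Fintype.card_pos_iff.mp (by omega)
  have h := packetLogμ_zpow_smul_logPacket_le_first p k hI Istar htame i m₀
  rwa [packetLogμ_zpow_smul_logPacket] at h

/-- **Upper end, first-inequality form**: for a bounded region `M ⊄ {0}` inside `⋃_i ι_i(g_i)·(R_I)^∼`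
(`‖g_i‖ = p^{−m_i/e_i}`, `i₀` a slot of least order `λ_min`), `I* ⊇` the non-tame slots:
`log μ̄(hull(⋃_{γ ∈ Ind2} γ·M)) ≤ δ_Λ + {−λ_min + d_I + 1 + 4|I*|/p}·log p` — the content lower bound
`⌊λ_min − d_I − a_I⌋ ≤ m` (abc-iut-w5-d180's `content_ge_of_subset_iUnion`) read through the exact formula and the
first inequality. [cite: Mochizuki2012, IUTchIV Prop. 1.4 (iii) p. 13, Thm 1.10 proof Step (v) p. 27–28] -/
theorem packetLogμ_packetHull_orbit_le_first (hI : 2 ≤ Fintype.card I) (Istar : Finset I)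
    (htame : ∀ i, i ∉ Istar → absRamificationIdx p (k i) ≤ p - 2) {M : Set (PacketAlgebra p k)}
    (hMb : IsPsiBounded p k M) (hM0 : ∃ x ∈ M, x ≠ 0)
    (g : Π i, k i) (mexp : I → ℤ) (hg : ∀ i, ‖g i‖ = (p : ℝ) ^ (-((mexp i : ℝ) / absRamificationIdx p (k i))))
    (i₀ : I) (hmin : ∀ i, (mexp i₀ : ℝ) / absRamificationIdx p (k i₀) ≤ (mexp i : ℝ) / absRamificationIdx p (k i))
    (hMU : M ⊆ ⋃ i, iota p k i (g i) • (normalizedPacket p k : Set (PacketAlgebra p k))) :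
    packetLogμ p k (packetHull p k (⋃ γ : indTwo p k, γ • M)) ≤
      (packetLogμ p k (packetHull p k (logPacket p k : Set (PacketAlgebra p k))) -
          packetLogμ p k (logPacket p k : Set (PacketAlgebra p k))) +
        (-((mexp i₀ : ℝ) / absRamificationIdx p (k i₀)) + dSum p k + 1 + 4 * (Istar.card : ℝ) / p)
          * Real.log p := by
  obtain ⟨m, -, hm1, -, hvol⟩ := exists_packetLogμ_packetHull_orbit_eq p k hMb hM0
  have hc := content_ge_of_subset_iUnion p k hI hm1 g mexp hg i₀ hmin hMU
  have h14 := neg_floor_mul_log_add_packetLogμ_logPacket_le p k hI Istar htame i₀ (mexp i₀)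
  have hlogp : 0 ≤ Real.log p := Real.log_nonneg (by exact_mod_cast (Fact.out : p.Prime).one_lt.le)
  have hc' : (⌊(mexp i₀ : ℝ) / absRamificationIdx p (k i₀) - dSum p k - aSum p k⌋ : ℝ) ≤ m := by
    exact_mod_cast hc
  rw [hvol]
  nlinarith

/-- The same upper end with the least order written as a norm: `log μ̄(hull(⋃_γ γ·M)) ≤ log‖g_{i₀}‖ + δ_Λ +
{d_I + 1 + 4|I*|/p}·log p` (`log‖g_{i₀}‖ = −λ_min·log p`). [cite: Mochizuki2012, IUTchIV Prop. 1.4 (iii) p. 13] -/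
theorem packetLogμ_packetHull_orbit_le_first' (hI : 2 ≤ Fintype.card I) (Istar : Finset I)
    (htame : ∀ i, i ∉ Istar → absRamificationIdx p (k i) ≤ p - 2) {M : Set (PacketAlgebra p k)}
    (hMb : IsPsiBounded p k M) (hM0 : ∃ x ∈ M, x ≠ 0)
    (g : Π i, k i) (mexp : I → ℤ) (hg : ∀ i, ‖g i‖ = (p : ℝ) ^ (-((mexp i : ℝ) / absRamificationIdx p (k i))))
    (i₀ : I) (hmin : ∀ i, (mexp i₀ : ℝ) / absRamificationIdx p (k i₀) ≤ (mexp i : ℝ) / absRamificationIdx p (k i))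
    (hMU : M ⊆ ⋃ i, iota p k i (g i) • (normalizedPacket p k : Set (PacketAlgebra p k))) :
    packetLogμ p k (packetHull p k (⋃ γ : indTwo p k, γ • M)) ≤
      Real.log ‖g i₀‖ +
        (packetLogμ p k (packetHull p k (logPacket p k : Set (PacketAlgebra p k))) -
          packetLogμ p k (logPacket p k : Set (PacketAlgebra p k))) +
        (dSum p k + 1 + 4 * (Istar.card : ℝ) / p) * Real.log p := by
  have h := packetLogμ_packetHull_orbit_le_first p k hI Istar htame hMb hM0 g mexp hg i₀ hmin hMU
  have hl := (slot_ne_zero_and_log_norm p k (hg i₀)).2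
  have hring : (-((mexp i₀ : ℝ) / absRamificationIdx p (k i₀)) + dSum p k + 1 + 4 * (Istar.card : ℝ) / p)
      * Real.log p = -((mexp i₀ : ℝ) / absRamificationIdx p (k i₀)) * Real.log p +
        (dSum p k + 1 + 4 * (Istar.card : ℝ) / p) * Real.log p := by ring
  rw [hl]
  linarith

/-- **The volume-form window**: for a bounded region `M` with `ι_{i₁}(g_{i₁})·(R_I)^∼ ⊆ M ⊆ ⋃_i ι_i(g_i)·(R_I)^∼`
(`‖g_i‖ = p^{−m_i/e_i}`, `i₀` of least order), writing `δ_Λ = log μ̄(hull(log_p(R_I^×))) − log μ̄(log_p(R_I^×))`: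
`log‖g_{i₁}‖ + δ_Λ ≤ log μ̄(hull(⋃_γ γ·M)) ≤ δ_Λ + {−λ_{i₀} + d_I + 1 + 4|I*|/p}·log p`; the width is
`{λ_{i₁} − λ_{i₀} + d_I + 1 + 4|I*|/p}·log p` (as `log‖g_{i₁}‖ = −λ_{i₁}·log p`).
[cite: Mochizuki2012, IUTchIV Prop. 1.4 (iii) p. 13] [cite: DupuyHilado2025, §4.9, §4.12] -/
theorem packetLogμ_packetHull_orbit_window (hI : 2 ≤ Fintype.card I) (Istar : Finset I)
    (htame : ∀ i, i ∉ Istar → absRamificationIdx p (k i) ≤ p - 2) {M : Set (PacketAlgebra p k)}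
    (hMb : IsPsiBounded p k M)
    (g : Π i, k i) (mexp : I → ℤ) (hg : ∀ i, ‖g i‖ = (p : ℝ) ^ (-((mexp i : ℝ) / absRamificationIdx p (k i))))
    (i₀ : I) (hmin : ∀ i, (mexp i₀ : ℝ) / absRamificationIdx p (k i₀) ≤ (mexp i : ℝ) / absRamificationIdx p (k i))
    (hMU : M ⊆ ⋃ i, iota p k i (g i) • (normalizedPacket p k : Set (PacketAlgebra p k)))
    (i₁ : I) (hgM : iota p k i₁ (g i₁) • (normalizedPacket p k : Set (PacketAlgebra p k)) ⊆ M) :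
    -((mexp i₁ : ℝ) / absRamificationIdx p (k i₁)) * Real.log p +
          (packetLogμ p k (packetHull p k (logPacket p k : Set (PacketAlgebra p k))) -
            packetLogμ p k (logPacket p k : Set (PacketAlgebra p k))) ≤
        packetLogμ p k (packetHull p k (⋃ γ : indTwo p k, γ • M)) ∧
      packetLogμ p k (packetHull p k (⋃ γ : indTwo p k, γ • M)) ≤
        (packetLogμ p k (packetHull p k (logPacket p k : Set (PacketAlgebra p k))) -
            packetLogμ p k (logPacket p k : Set (PacketAlgebra p k))) +
          (-((mexp i₀ : ℝ) / absRamificationIdx p (k i₀)) + dSum p k + 1 + 4 * (Istar.card : ℝ) / p)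
            * Real.log p := by
  have hg1 := slot_ne_zero_and_log_norm p k (hg i₁)
  have hM0 : ∃ x ∈ M, x ≠ 0 := by
    refine ⟨iota p k i₁ (g i₁), hgM ⟨1, Subring.one_mem _, ?_⟩, (map_ne_zero (iota p k i₁)).mpr hg1.1⟩
    change iota p k i₁ (g i₁) * 1 = iota p k i₁ (g i₁)
    rw [mul_one]
  refine ⟨?_, packetLogμ_packetHull_orbit_le_first p k hI Istar htame hMb hM0 g mexp hg i₀ hmin hMU⟩
  have h := packetLogμ_packetHull_orbit_ge_defect p k hMb hg1.1 hgM
  rw [hg1.2] at h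
  exact h

end Literature.IUT.LogVolume

end
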